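import Summits.NavierStokesRegularity.NavierStokesRegularity.Theses.GaldiLiouvilleGate
import Summits.NavierStokesRegularity.NavierStokesRegularity.Theorems.GaldiLiouvilleGateRecordZoomAncientStubZoomLimit
import Literature.Analysis.FluidPDE.SelfSimilarProofs
import HarnessLib

/-!
# `GaldiLiouvilleGate` / `TypeIQuarterGate`: the crux `ParabolicGaldiLiouville` (stmt-0893) HAS NO
# PERTURBATIVE REGIME — it is equivalent to its own small-data version

`--supports stmt-NavierStokesRegularity-0893` (helper for the registered line `birth`, whose one open
stub `stub_sharpTwoGate` is Lean-equivalent to the crux, p172200, and contains Galdi's open steady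
Liouville problem 0895).

The class of X2 = `ParabolicGaldiLiouville` — bounded ancient mild solutions `v` of Navier–Stokes
(`ν = 1`) on `ℝ³ × (−∞,0)`, smooth, with `sup_s ∫|∇v(s)|² < ∞` and `L⁶` slices — is invariant under the
Navier–Stokes scaling `v ↦ v_c = c·v(c²·, c·)` (`nsRescale`), and EVERY size it carries shrinks
under `c ↓ 0`: `sup|v_c| = c·sup|v|`, `∫|∇v_c(s)|² = c·∫|∇v(c²s)|²` (`‖v_c(s)‖₆ = √c‖v(c²s)‖₆`).
Hence (`parabolicGaldiLiouville_iff_small`): for every `ε > 0`,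

  X2 ⟺ X2 restricted to `sup|v| ≤ ε` AND `sup_s ∫|∇v(s)|² ≤ ε`.

Reading for the repair census of 0893: no Liouville theorem proved under SIMULTANEOUS smallness of
the sup norm and of the enstrophy can be "a rung" — it is the whole crux; a genuine rung must use a
scale-INVARIANT quantity (e.g. the ratio `sup_s∫|∇v(s)|² / sup|v|`, the `L³`/`L^{3,∞}` norms of gate
B, or the self-similar `L⁶`-rate of gate A of `stub_sharpTwoGate`).  Tools: the tree's scaling
lemmas `IsBoundedAncientMildSolution.nsRescale` / `IsAncientMildSolution.nsRescale_holds`,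
`lintegral_frobeniusNormSq_fderiv_smul_comp_space_affine`, `eLpNorm_comp_space_affine` (verbatim the
pattern of `RecordZoomAncient.Birth.normalise_nsRescale`).

HONEST FRAMING: elementary scaling bookkeeping; `ParabolicGaldiLiouville` (0893) and `GaldiLiouville`
(0895) remain OPEN; nothing about Navier–Stokes regularity is claimed. [cite: KNSS2009, §1] [folklore]
-/

noncomputable section

-- the problem directory repeats the summit name (`NavierStokesRegularity/NavierStokesRegularity`)
set_option linter.dupNamespace false

open Set MeasureTheory Filter Topology Function Literature.Analysis.FluidPDE
open scoped ENNReal NNReal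

namespace Summit.NavierStokesRegularity.NavierStokesRegularity.Theorems

namespace ParabolicGaldiLiouvilleScaling

open Summit.NavierStokesRegularity.NavierStokesRegularity.Theses.GaldiLiouvilleGate (ParabolicGaldiLiouville)
open Summit.NavierStokesRegularity.NavierStokesRegularity.Theorems.RecordZoomAncient.Birth
  (lintegral_frobeniusNormSq_fderiv_smul_comp_space_affine eLpNorm_comp_space_affine)

/-- **Scaling a class member down to size `ε`.** For a bounded ancient mild solution `v` (`ν = 1`),
smooth on `(−∞,0) × ℝ³`, with `|v| ≤ B`, `∫|∇v(s)|² ≤ D` and `L⁶` slices, and `0 < c` with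
`c·B ≤ ε`, `c·D ≤ ε`: the rescaled `nsRescale c v` is in the class with `|·| ≤ ε`, enstrophy `≤ ε`,
and is identically zero on `(−∞,0)` iff `v` is. [cite: KNSS2009, §1] -/
theorem small_nsRescale
    (v : ℝ → EuclideanSpace ℝ (Fin 3) → EuclideanSpace ℝ (Fin 3)) {B D ε c : ℝ} (hc : 0 < c)
    (hcB : c * B ≤ ε) (hcD : c * D ≤ ε)
    (hv : IsBoundedAncientMildSolution 1 v)
    (hsm : ContDiffOn ℝ (⊤ : ℕ∞) (Function.uncurry v) (Set.Iio 0 ×ˢ Set.univ))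
    (hB : ∀ s < 0, ∀ y, ‖v s y‖ ≤ B)
    (hens : ∀ s < 0, ∫⁻ y, ENNReal.ofReal (frobeniusNormSq (fderiv ℝ (v s) y)) ≤ ENNReal.ofReal D)
    (hL6 : ∀ s < 0, MemLp (v s) 6 volume) :
    IsBoundedAncientMildSolution 1 (nsRescale c v) ∧
      ContDiffOn ℝ (⊤ : ℕ∞) (Function.uncurry (nsRescale c v)) (Set.Iio 0 ×ˢ Set.univ) ∧
      (∀ s < 0, ∀ y, ‖nsRescale c v s y‖ ≤ ε) ∧
      (∀ s < 0, ∫⁻ y, ENNReal.ofReal (frobeniusNormSq (fderiv ℝ (nsRescale c v s) y)) ≤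
        ENNReal.ofReal ε) ∧
      (∀ s < 0, MemLp (nsRescale c v s) 6 volume) ∧
      ((∀ s < 0, ∀ y, nsRescale c v s y = 0) → ∀ s < 0, ∀ y, v s y = 0) := by
  have hc2 : 0 < c ^ 2 := by positivity
  have hneg : ∀ s < 0, c ^ 2 * s < 0 := fun s hs => mul_neg_of_pos_of_neg hc2 hs
  have hS : IsSmoothSpaceTimeOn (Iio 0) v := hsm
  have hslice : ∀ s < 0, ContDiff ℝ (⊤ : ℕ∞) (v s) := fun s hs =>
    hS.contDiff_slice (mem_Iio.2 hs)
  have hdiff : ∀ s < 0, Differentiable ℝ (v s) := fun s hs =>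
    (hslice s hs).differentiable (by simp)
  -- the slices of the rescaled field (shape of the tree's change-of-variables lemmas; this is the
  -- landed `RecordZoomAncient.Birth.nsRescale_slice_eq`, restated inline)
  have nsRescale_slice_eq_smul : ∀ s : ℝ,
      nsRescale c v s = c • fun y => v (c ^ 2 * s) (0 + c • y) := fun s => by
    funext y
    simp only [Pi.smul_apply, zero_add, nsRescale_apply]
  refine ⟨hv.nsRescale IsAncientMildSolution.nsRescale_holds one_pos hc, ?_, ?_, ?_, ?_, ?_⟩
  · -- smoothness: compose with the smooth self-map `(t, x) ↦ (c² t, c x)` of `(−∞,0) × ℝ³`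
    have hφ : ContDiff ℝ (⊤ : ℕ∞)
        (fun q : ℝ × EuclideanSpace ℝ (Fin 3) => (c ^ 2 * q.1, c • q.2)) :=
      (contDiff_const.mul contDiff_fst).prodMk (contDiff_snd.const_smul c)
    have hmaps : MapsTo (fun q : ℝ × EuclideanSpace ℝ (Fin 3) => (c ^ 2 * q.1, c • q.2))
        (Set.Iio 0 ×ˢ Set.univ) (Set.Iio 0 ×ˢ Set.univ) := by
      rintro ⟨t, x⟩ ⟨ht, -⟩
      exact ⟨hneg t ht, mem_univ _⟩
    have h := (hsm.comp hφ.contDiffOn hmaps).const_smul c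
    refine h.congr fun q _ => ?_
    rcases q with ⟨t, x⟩
    simp only [Function.uncurry_apply_pair, Function.comp_apply, nsRescale_apply]
  · -- sup norm: `|c v(c² s, c y)| = c |v| ≤ c B ≤ ε`
    intro s hs y
    rw [nsRescale_apply, norm_smul, Real.norm_of_nonneg hc.le]
    exact (mul_le_mul_of_nonneg_left (hB _ (hneg s hs) _) hc.le).trans hcB
  · -- enstrophy: `∫ |∇w(s)|² = c⁴ c⁻³ ∫ |∇v(c² s)|² ≤ c D ≤ ε`
    intro s hs
    rw [nsRescale_slice_eq_smul,
      lintegral_frobeniusNormSq_fderiv_smul_comp_space_affine hc c 0 (hdiff _ (hneg s hs)),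
      finrank_euclideanSpace_fin, ← ENNReal.ofReal_mul (by positivity)]
    have hcc : (c * c) ^ 2 * (c ^ 3)⁻¹ = c := by field_simp
    rw [hcc]
    calc ENNReal.ofReal c * ∫⁻ x, ENNReal.ofReal (frobeniusNormSq (fderiv ℝ (v (c ^ 2 * s)) x))
        ≤ ENNReal.ofReal c * ENNReal.ofReal D := by gcongr; exact hens _ (hneg s hs)
      _ = ENNReal.ofReal (c * D) := (ENNReal.ofReal_mul hc.le).symm
      _ ≤ ENNReal.ofReal ε := ENNReal.ofReal_le_ofReal hcD
  · -- `L⁶` slices: change of variables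
    intro s hs
    rw [nsRescale_slice_eq_smul]
    refine MemLp.const_smul ⟨?_, ?_⟩ c
    · exact ((hslice _ (hneg s hs)).continuous.comp
        (continuous_const.add (continuous_id.const_smul c))).aestronglyMeasurable
    · rw [eLpNorm_comp_space_affine hc 0 (v (c ^ 2 * s)) 6]
      exact ENNReal.mul_lt_top
        (ENNReal.rpow_lt_top_of_nonneg (by positivity) ENNReal.ofReal_ne_top)
        (hL6 _ (hneg s hs)).eLpNorm_lt_top
  · -- triviality transfers back: `v(s₀, y₀) = c⁻¹ w(s₀/c², y₀/c)`
    intro hzero s₀ hs₀ y₀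
    have h := hzero (s₀ / c ^ 2) (div_neg_of_neg_of_pos hs₀ hc2) (c⁻¹ • y₀)
    rw [nsRescale_apply, mul_div_cancel₀ _ hc2.ne', smul_inv_smul₀ hc.ne',
      smul_eq_zero] at h
    exact h.elim (fun h0 => absurd h0 hc.ne') id

/-- **`ParabolicGaldiLiouville` ⟺ its small-data version, for every `ε > 0`.** X2 holds iff it holds
for the members of its class with `|v| ≤ ε` on `(−∞,0) × ℝ³` AND `∫|∇v(s)|² ≤ ε` for all `s < 0`:
the class has no perturbative regime in these (non-scale-invariant) sizes. [cite: KNSS2009, §1] -/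
theorem parabolicGaldiLiouville_iff_small {ε : ℝ} (hε : 0 < ε) :
    ParabolicGaldiLiouville ↔
      ∀ v : ℝ → EuclideanSpace ℝ (Fin 3) → EuclideanSpace ℝ (Fin 3),
        IsBoundedAncientMildSolution 1 v →
        ContDiffOn ℝ (⊤ : ℕ∞) (Function.uncurry v) (Set.Iio 0 ×ˢ Set.univ) →
        (∀ s < 0, ∀ y, ‖v s y‖ ≤ ε) →
        (∀ s < 0, ∫⁻ y, ENNReal.ofReal (frobeniusNormSq (fderiv ℝ (v s) y)) ≤ ENNReal.ofReal ε) →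
        (∀ s < 0, MemLp (v s) 6 volume) → ∀ s < 0, ∀ y, v s y = 0 := by
  constructor
  · intro h v hv hsm _hB hens hL6
    exact h v hv hsm ⟨ε.toNNReal, fun s hs => (hens s hs).trans_eq rfl⟩ hL6
  · intro h v hv hsm hens hL6
    obtain ⟨C, hC⟩ := hens
    obtain ⟨B, hB⟩ := hv.2
    -- the scale `c = ε / (|B| + C + ε)` : `0 < c ≤ 1`, `c|B| ≤ ε`, `c C ≤ ε`
    set S : ℝ := |B| + C + ε with hS_def
    have hS0 : 0 < S := by positivity
    set c : ℝ := ε / S with hc_def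
    have hc : 0 < c := div_pos hε hS0
    have hcS : c * S = ε := div_mul_cancel₀ _ hS0.ne'
    have hcB : c * B ≤ ε := by
      have h1 : c * B ≤ c * |B| := mul_le_mul_of_nonneg_left (le_abs_self B) hc.le
      have h2 : c * |B| ≤ c * S := mul_le_mul_of_nonneg_left (by
        rw [hS_def]; linarith [NNReal.coe_nonneg C]) hc.le
      linarith
    have hcD : c * (C : ℝ) ≤ ε := by
      have h2 : c * (C : ℝ) ≤ c * S := mul_le_mul_of_nonneg_left (by
        rw [hS_def]; linarith [abs_nonneg B]) hc.le
      linarith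
    have hB' : ∀ s < 0, ∀ y, ‖v s y‖ ≤ B := fun s hs y => hB s (mem_Iio.2 hs) y
    have hens' : ∀ s < 0, ∫⁻ y, ENNReal.ofReal (frobeniusNormSq (fderiv ℝ (v s) y)) ≤
        ENNReal.ofReal (C : ℝ) := fun s hs => by
      rw [ENNReal.ofReal_coe_nnreal]; exact hC s hs
    obtain ⟨h1, h2, h3, h4, h5, h6⟩ :=
      small_nsRescale v hc hcB hcD hv hsm hB' hens' hL6
    exact h6 (h (nsRescale c v) h1 h2 h3 h4 h5)
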